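import Literature.NumberTheory.Sieve.ParityWave0
import HarnessLib

/-!
# The Barban–Davenport–Halberstam variance of the primes and its unconditional LOWER bound in the
# range √N ≤ Q ≤ N (Harper–Soundararajan 2017, Theorem 1)

Topic `Literature/NumberTheory/Sieve` (primes in arithmetic progressions). STATEMENT LAYER: the
centred BDH variance `V(N,Q) = Σ_{q ≤ Q} Σ*_{a (q)} (ψ(N;q,a) − ψ_q(N)/φ(q))²` as a definition over
the tree's `ParityWave0.chebyshevPsiMod` (= `ψ(x;q,a)`), and Harper–Soundararajan's Theorem 1 as a
NAMED FACT (unproved here). Typed for cell ls-idea (card K-I1-1 ★ «half-lattice form factor /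
variance floor», lens-1, critics A/B/C PASS; sketch `Sketch_VarianceFloor.lean` by seat ls-idea-lens-1):
the printed floor is the anchor of the seat's «second door» RS-var («beat the Harper–Soundararajan
constant by ε at one level Q = N^θ, θ ∈ (3/4,1)»), whose Prop is an idea object and is NOT stated
here. «The programme SEARCHES and TYPES; no claim about Landau–Siegel zeros until a kernel theorem
says so.»

## What the source prints (held text, read 2026-08-27)

**[HarperSoundararajan2017]** A. J. Harper, K. Soundararajan, *Lower bounds for the variance of
sequences in arithmetic progressions: primes and divisor functions*, Quart. J. Math. 68 (2017)
97–123 = arXiv:1602.01984, §1 [corpus:paper:arxiv-1602.01984 p0003:L28–L40]: "**Theorem 1.** Let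
`ε > 0` be given, and let `N` be large enough in terms of `ε`, and let `Q` be in the range
`√N ≤ Q ≤ N`. There exists an absolute constant `C` such that
`Σ_{q ≤ Q} Σ_{a (mod q), (a,q)=1} (ψ(N;q,a) − ψ_q(N)/φ(q))² ≥ (1−ε) QN (log(Q²/N) − C log log N)`,
where `ψ(N;q,a) := Σ_{n ≤ N, n ≡ a (q)} Λ(n)` and `ψ_q(N) := Σ_{n ≤ N, (n,q)=1} Λ(n)`."

## References
* [HarperSoundararajan2017] Thm. 1, p. 3. [held: paper:arxiv-1602.01984 p0003]
-/

noncomputable section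

open Finset
open Literature.NumberTheory.Sieve

namespace Literature.NumberTheory.Sieve

namespace BDHVariance

/-- `ψ_q(N) = Σ_{n ≤ N, (n,q)=1} Λ(n)`, as the sum of `ψ(N;q,a)` over the reduced classes `a`
(the tree's `ParityWave0.chebyshevPsiMod`). [cite: HarperSoundararajan2017, Thm. 1 (definition of ψ_q)] -/
def psiCoprime (q : ℕ) [NeZero q] (x : ℝ) : ℝ :=
  ∑ a : (ZMod q)ˣ, ParityWave0.chebyshevPsiMod q (a : ZMod q) x

/-- The centred variance at ONE modulus: `Σ_{a (q), (a,q)=1} (ψ(x;q,a) − ψ_q(x)/φ(q))²` (junk `0`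
at `q = 0`). [cite: HarperSoundararajan2017, Thm. 1 (the inner sum)] -/
def classVarianceAt (q : ℕ) (x : ℝ) : ℝ :=
  if hq : q = 0 then 0 else
    haveI : NeZero q := ⟨hq⟩
    ∑ a : (ZMod q)ˣ,
      (ParityWave0.chebyshevPsiMod q (a : ZMod q) x - psiCoprime q x / (Nat.totient q : ℝ)) ^ 2

/-- **The Barban–Davenport–Halberstam variance** `V(x,Q) = Σ_{1 ≤ q ≤ Q} Σ*_{a (q)} (ψ(x;q,a) − ψ_q(x)/φ(q))²`
(Harper–Soundararajan's centred form, "the true variance").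
[cite: HarperSoundararajan2017, Thm. 1 (left side)] -/
def bdhVariance (x : ℝ) (Q : ℕ) : ℝ :=
  ∑ q ∈ Finset.Icc 1 Q, classVarianceAt q x

/-- Each class term is non-negative, hence so is the variance. [cite: HarperSoundararajan2017, Thm. 1] -/
theorem classVarianceAt_nonneg (q : ℕ) (x : ℝ) : 0 ≤ classVarianceAt q x := by
  unfold classVarianceAt
  split_ifs
  · exact le_rfl
  · exact Finset.sum_nonneg fun _ _ ↦ sq_nonneg _

/-- `V(x,Q) ≥ 0`. [cite: HarperSoundararajan2017, Thm. 1] -/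
theorem bdhVariance_nonneg (x : ℝ) (Q : ℕ) : 0 ≤ bdhVariance x Q :=
  Finset.sum_nonneg fun q _ ↦ classVarianceAt_nonneg q x

/-- `V(x,·)` is monotone in `Q`. [cite: HarperSoundararajan2017, Thm. 1] -/
theorem bdhVariance_mono (x : ℝ) {Q Q' : ℕ} (h : Q ≤ Q') : bdhVariance x Q ≤ bdhVariance x Q' :=
  Finset.sum_le_sum_of_subset_of_nonneg (Finset.Icc_subset_Icc le_rfl h)
    fun q _ _ ↦ classVarianceAt_nonneg q x

end BDHVariance

/-- **Harper–Soundararajan 2017, Theorem 1** (as printed; NAMED FACT, unproved here): there is an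
ABSOLUTE constant `C` such that for every `ε > 0`, all `N` large in terms of `ε`, and all `Q` with
`√N ≤ Q ≤ N`, `V(N,Q) ≥ (1 − ε) Q N (log(Q²/N) − C log log N)`. (Unconditional; continues the
Barban–Davenport–Halberstam / Montgomery / Hooley line, cf. the paper's §1.)
[cite: HarperSoundararajan2017, Thm. 1] -/
def harperSoundararajan2017_theorem1 : Prop :=
  ∃ C : ℝ, ∀ ε : ℝ, 0 < ε → ∃ N₀ : ℕ, ∀ N : ℕ, N₀ ≤ N → ∀ Q : ℕ,
    Real.sqrt N ≤ (Q : ℝ) → Q ≤ N →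
      (1 - ε) * (Q : ℝ) * N * (Real.log ((Q : ℝ) ^ 2 / N) - C * Real.log (Real.log N)) ≤
        BDHVariance.bdhVariance (N : ℝ) Q

end Literature.NumberTheory.Sieve
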